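import Summits.MatrixMultiplication.OmegaCensus.DominoZ5Z5Cover19S5R00
import Summits.MatrixMultiplication.OmegaCensus.DominoZ5Z5Cover19S5Row03
import Summits.MatrixMultiplication.OmegaCensus.DominoZ5Z5Cover19S5Row04
import Summits.MatrixMultiplication.OmegaCensus.DominoZ5Z5Cover19S5Row06
import Summits.MatrixMultiplication.OmegaCensus.DominoZ5Z5Cover19S5Row09
import Summits.MatrixMultiplication.OmegaCensus.DominoZ5Z5Cover19S5Row11
import Summits.MatrixMultiplication.OmegaCensus.DominoZ5Z5Cover19S5R12
import Summits.MatrixMultiplication.OmegaCensus.DominoZ5Z5Cover19S5Row21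
import Summits.MatrixMultiplication.OmegaCensus.DominoZ5Z5Cover19S5Row22
import Summits.MatrixMultiplication.OmegaCensus.DominoZ5Z5Cover19S5Row23
import Summits.MatrixMultiplication.OmegaCensus.DominoZ5Z5Cover19S5R24
import Summits.MatrixMultiplication.OmegaCensus.DominoZ5Z5Cover19S5R26
import Summits.MatrixMultiplication.OmegaCensus.DominoZ5Z5Cover19S5R28
import Summits.MatrixMultiplication.OmegaCensus.DominoZ5Z5Cover19S5R30
import Summits.MatrixMultiplication.OmegaCensus.DominoZ5Z5Join19S5
import Summits.MatrixMultiplication.OmegaCensus.DominoZ5Z5Sound19S5C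
import Summits.MatrixMultiplication.OmegaCensus.DominoZ5Z5Pins19S5P00
import Summits.MatrixMultiplication.OmegaCensus.DominoZ5Z5Pins19S5P01
import Summits.MatrixMultiplication.OmegaCensus.DominoZ5Z5Pins19S5P02
import Summits.MatrixMultiplication.OmegaCensus.DominoZ5Z5Pins19S5P03
import Summits.MatrixMultiplication.OmegaCensus.DominoZ5Z5RefChk19S5
import Summits.MatrixMultiplication.OmegaCensus.DominoZ5Z5Cover19Defs
import HarnessLib

/-!
# The `ℤ₅²` stage of `(1,9,12)@325`, hole class `σ = 5`: assembly of the finite statement `fin19s5`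

ω-census `pub-omega`, family (b3), seat pub-omega-group gen 37 (staged) / gen 38 (cover pieces, soundness chunking, assembly).  Framing: lottery ticket; floor = certified
bounds/negative ranges.  VALUE: kernel computations / assembly of the `ℤ₅²` stage of the census cell `(1,9,12)@325` of `ℤ₅ × ℤ₆₅`
(design `HOME/pub-omega-group-g37/DESIGN-1-9-12.md`); NOT progress on ω.
Assembles the 32 per-row cover computations (piecewise rows recombined in `DominoZ5Z5Join19S5`), the chunked soundness check
`sound19s5` (`DominoZ5Z5Sound19S5C`), the filtered-list hypotheses,
the dispatch programs and the refutation check into **`fin19s5`** — literally the hypothesis `hfin5` of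
`no_cube_form_19_of_fin` (`DominoZ5Z65Cell19Core.lean`).
-/

namespace Summit.MatrixMultiplication.OmegaCensus

namespace Z5Z5ThreeSet

open Finset ZpZpDomino

/-- The program over a row list is the conjunction of the programs over its rows. [folklore] -/
theorem coverGenE3_rows19s5 (Rlist : List (List ℕ))
    (h : ∀ R ∈ Rlist, coverGenE3 tree19s5 exc19s5 10 (rowWs 5 10) (diagIdx 5) [R] flCg19s5.flatten flD19s5 (offs 5 10)
      (off 5 10 1) (off 5 10 2) = true) :
    coverGenE3 tree19s5 exc19s5 10 (rowWs 5 10) (diagIdx 5) Rlist flCg19s5.flatten flD19s5 (offs 5 10) (off 5 10 1)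
      (off 5 10 2) = true := by
  unfold coverGenE3 at h ⊢
  rw [List.all_eq_true]
  intro R hR
  have h1 := h R hR
  rw [List.all_eq_true] at h1
  exact h1 R (by simp)

/-- **All flagged rows are covered.** [folklore] -/
theorem cov19s5 : coverGenE3 tree19s5 exc19s5 10 (rowWs 5 10) (diagIdx 5) flR19s5 flCg19s5.flatten flD19s5 (offs 5 10)
    (off 5 10 1) (off 5 10 2) = true := by
  refine coverGenE3_rows19s5 _ fun R hR => ?_
  have hR' : R ∈ (List.range 32).map (fun a => flR19s5.getD a []) := by
    have e : (List.range 32).map (fun a => flR19s5.getD a []) = flR19s5 := by decide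
    rw [e]; exact hR
  simp only [List.mem_map, List.mem_range] at hR'
  obtain ⟨a, ha, rfl⟩ := hR'
  interval_cases a
  · exact cov19s5_r0
  · exact cov19s5_r1
  · exact cov19s5_r2
  · exact cov19s5_r3
  · exact cov19s5_r4
  · exact cov19s5_r5
  · exact cov19s5_r6
  · exact cov19s5_r7
  · exact cov19s5_r8
  · exact cov19s5_r9
  · exact cov19s5_r10
  · exact cov19s5_r11
  · exact cov19s5_r12
  · exact cov19s5_r13
  · exact cov19s5_r14
  · exact cov19s5_r15
  · exact cov19s5_r16
  · exact cov19s5_r17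
  · exact cov19s5_r18
  · exact cov19s5_r19
  · exact cov19s5_r20
  · exact cov19s5_r21
  · exact cov19s5_r22
  · exact cov19s5_r23
  · exact cov19s5_r24
  · exact cov19s5_r25
  · exact cov19s5_r26
  · exact cov19s5_r27
  · exact cov19s5_r28
  · exact cov19s5_r29
  · exact cov19s5_r30
  · exact cov19s5_r31

/-- Filtered-list hypotheses: every flagged row / column / diagonal vector is listed. [folklore] -/
theorem flagged_listed19s5 :
    (∀ R ∈ compsLB [] 5 9, tree19s5.mem (polyBE 10 R) = true → R ∈ flR19s5) ∧
    (∀ C ∈ compsLB [] 5 9, tree19s5.mem (off 5 10 1 + polyBE 10 C) = true → C ∈ flCg19s5.flatten) ∧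
    (∀ D ∈ compsLB [] 5 9, tree19s5.mem (off 5 10 2 + polyBE 10 D) = true → D ∈ flD19s5) := by
  refine ⟨?_, ?_, ?_⟩ <;> decide +kernel

/-- The flat exception lists agree with the row matrices. [folklore] -/
theorem excFlat19s5_spec : ∀ k < 100, ∀ i < 25,
    ((excFlat19s5.getD k []).getD i 0) = ((exc19s5.getD k []).getD (i / 5) []).getD (i % 5) 0 := by decide +kernel

/-- All pins of this class. [folklore] -/
def pinsAll19s5 : List (ℕ × List ℕ × List (ℕ × ℕ × List ℕ) × List (ℕ × List ℕ)) := pins19s5p00 ++ pins19s5p01 ++ pins19s5p02 ++ pins19s5p03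

/-- Every exception index is refuted or pinned. [folklore] -/
theorem excCovered19s5 : ∀ k < 100, ((refute19s5.any fun c => c.1 == k) || (pinsAll19s5.any fun p => p.1 == k)) = true := by
  decide +kernel

/-- The dispatch programs of all parts. [folklore] -/
theorem dispAll19s5 : ∀ p ∈ pinsAll19s5, pinOK19 5 excFlat19s5 p = true := by
  have h : pinsAll19s5.all (pinOK19 5 excFlat19s5) = true := by
    simp only [pinsAll19s5, List.all_append, disp19s5p00_eq, disp19s5p01_eq, disp19s5p02_eq, disp19s5p03_eq, Bool.and_self]
  exact List.all_eq_true.1 h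

/-- **The finite `ℤ₅²`-stage statement for hole class `σ = 5`** (the hypothesis `hfin5` of
`no_cube_form_19_of_fin`). [folklore] -/
theorem fin19s5 : ∀ g : Fin (5 * 5) → ℕ, ∑ i, g i = 9 →
    (∃ j < 6, certAt19 5 j (cnts 5 j g) = true) ∨
    ∃ e : List ℕ, (∀ i : Fin (5 * 5), g i = e.getD i.val 0) ∧
      ((∃ c : ℕ × ℕ × List ℤ, c.1 < 25 ∧ refuteRowOK1 e 5 c = true) ∨
       (∃ h : List ℕ, ∃ rows : List (ℕ × List ℤ), pinRowsOK1 e 5 h rows = true ∧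
          ∀ r : ZMod 5 × ZMod 5, gridFn e r ≠ 0 → gridFn e r = 1 ∧ ∃ L : List ℕ, momentCertOK1 e h L r (pt 5 5) = true)) := by
  intro g hg
  obtain ⟨hR, hC, hD⟩ := flagged_listed19s5
  rcases exists_cert_or_exc_of_coverGenE3 (p := 5) (by norm_num) tree19s5 exc19s5 flR19s5 flCg19s5.flatten flD19s5 hR hC hD
      cov19s5 (certAt19 5) sound19s5 g hg with ⟨j, hj, hc⟩ | hmem
  · exact Or.inl ⟨j, by omega, hc⟩
  · obtain ⟨k, hk, hrow⟩ := List.getElem_of_mem hmem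
    have hK : k < 100 := by simpa [exc19s5] using hk
    have hgetD : exc19s5.getD k [] = exc19s5[k] := List.getD_eq_getElem _ _ hk
    have hg' : ∀ i : Fin (5 * 5), g i = (excFlat19s5.getD k []).getD i.val 0 := by
      intro i
      have ht : i.val / 5 < 5 := by omega
      have hu : i.val % 5 < 5 := Nat.mod_lt _ (by omega)
      have hcell : cell (⟨i.val / 5, ht⟩ : Fin 5) ⟨i.val % 5, hu⟩ = i := Fin.ext (by rw [cell_val]; exact Nat.div_add_mod' i.val 5)
      have h1 := apply_cell_of_rowsOf_eq hrow.symm ⟨i.val / 5, ht⟩ ⟨i.val % 5, hu⟩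
      rw [hcell] at h1
      rw [h1, excFlat19s5_spec k hK i.val i.isLt, hgetD]
      rfl
    refine Or.inr ⟨excFlat19s5.getD k [], hg', ?_⟩
    have hcov := excCovered19s5 k hK
    rw [Bool.or_eq_true] at hcov
    rcases hcov with href | hpin
    · left
      rw [List.any_eq_true] at href
      obtain ⟨c, hc, hck⟩ := href
      rw [beq_iff_eq] at hck
      have hall := List.all_eq_true.1 refChk19s5 c hc
      rw [Bool.and_eq_true, decide_eq_true_eq, hck] at hall
      exact ⟨_, hall.1, hall.2⟩
    · right
      rw [List.any_eq_true] at hpin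
      obtain ⟨p, hp, hpk⟩ := hpin
      rw [beq_iff_eq] at hpk
      have hall := dispAll19s5 p hp
      rw [pinOK19, hpk, Bool.and_eq_true, List.all_eq_true] at hall
      obtain ⟨hrows, hsupp⟩ := hall
      refine ⟨p.2.1, zrows p.2.2.1, hrows, fun r hr => ?_⟩
      have hi := hsupp (ptIdx 5 r) (List.mem_range.2 (ptIdx_lt 5 r))
      rw [Bool.or_eq_true, beq_iff_eq, Bool.and_eq_true, beq_iff_eq, List.any_eq_true] at hi
      unfold gridFn at hr ⊢
      rcases hi with h0 | ⟨h1, lc, -, hlc⟩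
      · exact absurd h0 hr
      · rw [Bool.and_eq_true, beq_iff_eq] at hlc
        refine ⟨h1, lc.2, ?_⟩
        rw [← pt_ptIdx 5 r]
        exact hlc.2

end Z5Z5ThreeSet

end Summit.MatrixMultiplication.OmegaCensus
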